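import Summits.QuantumFields.YangMills.Theorems.BalabanUVNodesN12GaugeLetterLocExplicit
import Literature.MathematicalPhysics.QuantumFieldTheory.Balaban1983to89.B14SeparationOfRecord
import Literature.MathematicalPhysics.QuantumFieldTheory.Balaban1983to89.B15Claim189CubePin
import HarnessLib

/-!
# DAG node N12 [B15] — FAR-DATUM SURGERY, PRELIMINARIES: the collar of `Ω₁(Z)` on the cover, and NODE 00's class reads only the bonds inside `Z`

Cell `pub-ymgap` (HUMAN RULINGS D-0062 ∕ D-0149), width seat `pub-ymgap-dag-n12-w6` g18.  Key K1⁹ `stmt-QuantumFields-27364`, `--kind proof --supports … --as helper`;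
count-neutral; THEOREMS ONLY (0 `def`, 0 `instance`, 0 `sorry`).

WHY (cell bus 2026-08-29, ⚑ LOCATED-DATUM-FAR).  The (σ)_N letter of record `N12GaugeLetterLocExplicit.exists_gaugeLetterLoc_atRecord_explicit` asks its region datum `W` to be
`ρn`-flat on a bond set `𝒞` containing the `k`-shadow of EVERY face-crossing member of `𝐁_k(Z)` — at level `0` these are all fine bonds meeting `Ω₁(Z)ᶜ ⊇ Zᶜ` ([III] (2.2)
`Γ₀ = Ω₁ᶜ`), so `𝒞` reaches arbitrarily far off `Z`, where the knit's datum `ext V_k = V_k` is a bare large-field variable.  THIS FILE proves that the variational problem does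
not care: if two `k`-data `W, W′` agree on the `k`-bonds INSIDE `Z^{(k)}`, the SURGERED configuration (`U₀` on the fine bonds with both ends in `Z`, the pulled-back datum
`Q_k^{s*}W′` elsewhere) is a (2.12) minimiser for `M˙(Q_k^{s*}W′)` whenever `U₀` is one for `M˙(Q_k^{s*}W)` — so the (σ)_N producer may be run at the LOCALISED datum
(`W′ := W` on `Z^{(k)}`, `1` off it; next file `…N12GaugeLetterLocExplicitOnZ`).

[Balaban1988Convergent] = «[III]», (2.2) p. 255 (`Γ₀ = Ω₁ᶜ`), (2.10)–(2.13) pp. 256–257, (1.3) p. 246; [Balaban1985Variational] = «[15]», (2)–(4) p. 278; [Balaban1985RegularSpaces] (1.7),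
(1.9) p. 77; [Balaban1987RG1] (0.2) p. 252, (0.4) p. 253.

CONTENTS (namespace `Summit.QuantumFields.YangMills.BalabanUVNodes.N12FarDatumSurgeryPrelim`; the surgery theorem itself is the next file `…N12FarDatumSurgery`).
* §1 collar bookkeeping on the universal cover ([III] (2.13) «dist(Ω₁, Ω₀ᶜ) ≥ LξM₁», the tree's `dist_maxDomT` at `n = 0`): a fine site within `L·M₁ − 1` of `Ω₁(Z)` lies in `Z`;
  the support of record `hullD M₁ 1 Ω₁` lies within `2M₁ − 1`; unit steps move one unit.
* §2 NODE 00's class `U_k({Ω_j(Z)}, εr)` reads a configuration only on the fine bonds with both ends in `Z` (`coDivSum_congr`, ★★ `mem_regMSCoPOfRecord_of_eqOn_inside`; margin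
  `2M₁ + 4 ≤ L·M₁`, i.e. `L ≥ 3 ∧ M₁ ≥ 4`).

HONEST FRAMING.  Lattice bookkeeping + one plaquette-wise action identity; nothing of Bałaban's estimates asserted or refuted; count-neutral helper; N12 NOT discharged; K1⁹ NOT
closed; counts unmoved; one finite 𝕋⁴ programme at fixed ε — R4 closes the conditional rung `BalabanLadder.UV` only; NOT continuum ∕ OS ∕ mass gap ∕ Clay.
-/

noncomputable section

open scoped BigOperators

namespace Summit.QuantumFields.YangMills.BalabanUVNodes.N12FarDatumSurgeryPrelim

open Set
open Literature.MathematicalPhysics.QuantumFieldTheory.Balaban1983to89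
open T4Continuum GaugeField B15DeterminingSets BlockAveraging
open B14.Eq213MaximalDomains (side)
open B14.Eq213DetSet (Bj Bj_zero Bj_mid Bj_top maxDomT maxDomT_zero maxDomT_subset maxDomT_antitone dist_maxDomT isBlockUnion_maxDomT)
open B14.Eq22Determines (blockIter IsBlockUnion)
open B14DomainGeom (Pt Within)
open B15Eq112TorusCover (cover lift cover_lift cover_apply)
open B15Claim189CubePin (cover_add_single)
open B10StarCount (shift_unshift unshift_shift)
open B14SeparationOfRecord (mem_hullD_iff)
open B5Eq118OneStroke (iterBlockOf)
open B8Eq17ClassAkV1 (plaqsOf mem_plaqsOf)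
open Literature.MathematicalPhysics.QuantumFieldTheory.BalabanImbrieJaffe1984to88.BIJ85Eq453GaugeField (qsstarGIter0)
open B14.Eq216Concrete (qsstarGIter0_eq)

variable {P : Params}

/-! ## §1  Collar bookkeeping on the cover -/

section Collar

variable {M₁ : ℕ} {Z : Set (Site P 0)} {k : ℕ}

/-- The cover intertwines the inverse unit translations: `π (z − e_μ) = (π z).unshift μ`. [cite: Balaban1987RG1, (0.1) p.251 (the torus)] -/
theorem cover_sub_single (z : Pt P.d) (μ : Fin P.d) : cover P (z - Pi.single μ 1) = (cover P z).unshift μ := by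
  have h := cover_add_single (P := P) (z - Pi.single μ 1) μ
  rw [sub_add_cancel] at h
  rw [h, unshift_shift]

/-- A unit step moves a cover point by one in the sup-metric. [folklore] -/
theorem within_add_single {r : ℤ} {z₁ z : Pt P.d} (h : Within r z₁ z) (μ : Fin P.d) : Within (r + 1) z₁ (z + Pi.single μ 1) := by
  intro i
  have hi := h i
  rw [Pi.add_apply]
  by_cases hμ : i = μ
  · subst hμ; rw [Pi.single_eq_same]
    rw [abs_le] at hi ⊢; constructor <;> linarith [hi.1, hi.2]
  · rw [Pi.single_eq_of_ne hμ, add_zero]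
    rw [abs_le] at hi ⊢; constructor <;> linarith [hi.1, hi.2]

/-- A backward unit step moves a cover point by one in the sup-metric. [folklore] -/
theorem within_sub_single {r : ℤ} {z₁ z : Pt P.d} (h : Within r z₁ z) (μ : Fin P.d) : Within (r + 1) z₁ (z - Pi.single μ 1) := by
  intro i
  have hi := h i
  rw [Pi.sub_apply]
  by_cases hμ : i = μ
  · subst hμ; rw [Pi.single_eq_same]
    rw [abs_le] at hi ⊢; constructor <;> linarith [hi.1, hi.2]
  · rw [Pi.single_eq_of_ne hμ, sub_zero]
    rw [abs_le] at hi ⊢; constructor <;> linarith [hi.1, hi.2]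

/-- One forward lattice step away from a cover witness. [folklore] -/
theorem near_shift {r : ℤ} {x : Site P 0} (h : ∃ z₁ z : Pt P.d, cover P z₁ ∈ maxDomT M₁ Z 1 ∧ cover P z = x ∧ Within r z₁ z) (μ : Fin P.d) :
    ∃ z₁ z : Pt P.d, cover P z₁ ∈ maxDomT M₁ Z 1 ∧ cover P z = x.shift μ ∧ Within (r + 1) z₁ z := by
  obtain ⟨z₁, z, h1, h2, h3⟩ := h
  exact ⟨z₁, z + Pi.single μ 1, h1, by rw [cover_add_single, h2], within_add_single h3 μ⟩

/-- One backward lattice step away from a cover witness. [folklore] -/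
theorem near_unshift {r : ℤ} {x : Site P 0} (h : ∃ z₁ z : Pt P.d, cover P z₁ ∈ maxDomT M₁ Z 1 ∧ cover P z = x ∧ Within r z₁ z) (μ : Fin P.d) :
    ∃ z₁ z : Pt P.d, cover P z₁ ∈ maxDomT M₁ Z 1 ∧ cover P z = x.unshift μ ∧ Within (r + 1) z₁ z := by
  obtain ⟨z₁, z, h1, h2, h3⟩ := h
  exact ⟨z₁, z - Pi.single μ 1, h1, by rw [cover_sub_single, h2], within_sub_single h3 μ⟩

/-- Weakening the radius of a cover witness. [folklore] -/
theorem near_mono {r r' : ℤ} (hr : r ≤ r') {x : Site P 0} (h : ∃ z₁ z : Pt P.d, cover P z₁ ∈ maxDomT M₁ Z 1 ∧ cover P z = x ∧ Within r z₁ z) :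
    ∃ z₁ z : Pt P.d, cover P z₁ ∈ maxDomT M₁ Z 1 ∧ cover P z = x ∧ Within r' z₁ z := by
  obtain ⟨z₁, z, h1, h2, h3⟩ := h
  exact ⟨z₁, z, h1, h2, h3.mono hr⟩

/-- **THE COLLAR OF `Ω₁(Z)` INSIDE `Z`** ([III] (2.13) «dist(Ω₁, Ω₀ᶜ) ≥ LξM₁», the tree's `dist_maxDomT` at `n = 0`): a fine site within `L·M₁ − 1` (sup-metric, on the cover) of a
point of `Ω₁(Z)` lies in `Z = Ω₀` (torus divisibility read at the top scale `k ≥ 1`). [cite: Balaban1988Convergent, (2.13) pp.256–257] -/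
theorem mem_of_near (hM : 1 ≤ M₁) (hk1 : 1 ≤ k) (hdiv : side P.L M₁ k ∣ P.sitesPerDir 0) {r : ℤ} (hr : r ≤ ((side P.L M₁ 1 : ℕ) : ℤ) - 1) {x : Site P 0}
    (h : ∃ z₁ z : Pt P.d, cover P z₁ ∈ maxDomT M₁ Z 1 ∧ cover P z = x ∧ Within r z₁ z) : x ∈ Z := by
  obtain ⟨z₁, z, h1, h2, h3⟩ := h
  have := dist_maxDomT hM hdiv (n := 0) hk1 h1 (h3.mono hr)
  rwa [maxDomT_zero, h2] at this

/-- A point of `Ω_j(Z)`, `j ≥ 1`, is its own cover witness at radius `0`. [cite: Balaban1988Convergent, (2.13) pp.256–257] -/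
theorem near_of_mem_maxDomT (hM : 1 ≤ M₁) {j : ℕ} (hj : 1 ≤ j) {x : Site P 0} (hx : x ∈ maxDomT M₁ Z j) :
    ∃ z₁ z : Pt P.d, cover P z₁ ∈ maxDomT M₁ Z 1 ∧ cover P z = x ∧ Within 0 z₁ z :=
  ⟨lift P x, lift P x, by rw [cover_lift]; exact maxDomT_antitone hM Z hj hx, cover_lift x, B14DomainGeom.Within.refl le_rfl _⟩

/-- **THE SUPPORT OF RECORD IS `2M₁ − 1`-NEAR `Ω₁(Z)`**: a point of `hullD M₁ 1 Ω₁` (one layer of `M₁`-cubes around `Ω₁`, [III] p. 255) has a cover witness at radius `2M₁ − 1` (its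
`M₁`-cube and the point of `Ω₁` in the cube's one-layer collar share the cube index). [cite: Balaban1988Convergent, p.255, (2.16)–(2.17) p.257] -/
theorem near_of_mem_hullD {x : Site P 0} (hx : x ∈ Node00.hullD P M₁ 1 (maxDomT M₁ Z 1)) :
    ∃ z₁ z : Pt P.d, cover P z₁ ∈ maxDomT M₁ Z 1 ∧ cover P z = x ∧ Within (2 * (M₁ : ℤ) - 1) z₁ z := by
  obtain ⟨a, -, ⟨y, hya, hyΩ⟩, hxa⟩ := mem_hullD_iff.1 hx
  obtain ⟨z₁, hz₁, rfl⟩ := hya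
  obtain ⟨z, hz, rfl⟩ := hxa
  refine ⟨z₁, z, hyΩ, rfl, fun i => ?_⟩
  have h1 := hz₁ i
  have h2 := hz i
  simp only [one_mul, Nat.cast_zero, zero_mul] at h1 h2
  rw [abs_le]
  constructor <;> linarith [h1.1, h1.2, h2.1, h2.2]

end Collar

/-! ## §2  NODE 00's class reads only the fine bonds with both ends in `Z` -/

section ClassLocality

variable {N : ℕ} [NeZero N]

/-- Unit translations commute. [folklore] -/
private theorem shift_shift_comm {j : ℕ} (x : Site P j) (μ ν : Fin P.d) : (x.shift μ).shift ν = (x.shift ν).shift μ := by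
  funext κ
  by_cases h1 : κ = ν
  · subst h1
    by_cases h2 : κ = μ
    · subst h2; rfl
    · simp [Site.shift, Function.update_apply, h2]
  · by_cases h2 : κ = μ
    · subst h2; simp [Site.shift, Function.update_apply, h1]
    · simp [Site.shift, Function.update_apply, h1, h2]

/-- The plaquette variable reads the four bonds of the plaquette: agreement on the bonds with both ends in a site set containing the four corners suffices.
[cite: Balaban1985Averaging, (9) p.19] -/
theorem plaqHol_congr_of_corners {j : ℕ} {G : Type*} [GaugeGroup G] {X : Set (Site P j)} {U U' : GaugeField P j G}
    (h : ∀ b : PBond P j, b.src ∈ X → b.tgt ∈ X → U b = U' b) (p : Plaq P j)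
    (h1 : p.src ∈ X) (h2 : p.src.shift p.μ ∈ X) (h3 : p.src.shift p.ν ∈ X) (h4 : (p.src.shift p.μ).shift p.ν ∈ X) :
    plaqHol U p = plaqHol U' p := by
  have h4' : (p.src.shift p.ν).shift p.μ ∈ X := by rw [← shift_shift_comm]; exact h4
  unfold plaqHol
  rw [h ⟨p.src, p.μ⟩ h1 h2, h ⟨p.src.shift p.μ, p.ν⟩ h2 h4, h ⟨p.src.shift p.ν, p.μ⟩ h3 h4', h ⟨p.src, p.ν⟩ h1 h3]

/-- **LOCALITY OF THE CO-DIVERGENCE** ([Balaban1985RegularSpaces] (1.1)–(1.2)): `η·(D^{η*}_U ∂U)(x, x+e_μ)` reads `U` only through the plaquette variables at the sources `x`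
and `x − e_ν` and the backward bonds `⟨x − e_ν, ν⟩`. [cite: Balaban1985RegularSpaces, (1.1)–(1.2) p.76, (1.9) p.77] -/
theorem coDivSum_congr {j : ℕ} {U U' : GaugeField P j (Node00.SU N)} {x : Site P j}
    (hplaq : ∀ y : Site P j, (y = x ∨ ∃ ν, y = x.unshift ν) → ∀ (α β : Fin P.d) (h : α < β), plaqHol U ⟨y, α, β, h⟩ = plaqHol U' ⟨y, α, β, h⟩)
    (hb : ∀ ν : Fin P.d, U ⟨x.unshift ν, ν⟩ = U' ⟨x.unshift ν, ν⟩) (μ : Fin P.d) :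
    Node00.Sect2.coDivSum U x μ = Node00.Sect2.coDivSum U' x μ := by
  unfold Node00.Sect2.coDivSum
  refine Finset.sum_congr rfl fun ν _ => ?_
  have hT : ∀ (α β : Fin P.d) (h : α < β), Node00.Sect2.coDivTerm U x ν α β h = Node00.Sect2.coDivTerm U' x ν α β h := fun α β h => by
    unfold Node00.Sect2.coDivTerm Node00.Sect2.plaqMat
    rw [hb ν, hplaq _ (Or.inr ⟨ν, rfl⟩) α β h, hplaq _ (Or.inl rfl) α β h]
  by_cases h : ν < μ
  · rw [dif_pos h, dif_pos h, hT]
  · rw [dif_neg h, dif_neg h]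
    by_cases h' : μ < ν
    · rw [dif_pos h', dif_pos h', hT]
    · rw [dif_neg h', dif_neg h']

variable {F : T4Family} {Kt k : ℕ} {ν : Node00.Stage7Numerics} {Z : Set (Site (F.P Kt) 0)}

/-- The margin arithmetic: `2M₁ + 3 ≤ L·M₁ − 1` once `L ≥ 3` and `M₁ ≥ 4`. [folklore] -/
theorem margin_le (hM4 : 4 ≤ ν.M₁) : (2 : ℤ) * (ν.M₁ : ℤ) - 1 + 1 + 1 + 1 + 1 ≤ ((side (F.P Kt).L ν.M₁ 1 : ℕ) : ℤ) - 1 := by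
  have hL : 3 ≤ (F.P Kt).L := T4ReflectionCone.three_le_L (F.P Kt)
  unfold side
  push_cast
  nlinarith [hL, hM4]

/-- A corner-meeting plaquette of a region whose points have cover witnesses at radius `2M₁ − 1` has its source witnessed at radius `2M₁ + 1`.
[cite: Balaban1985RegularSpaces, p.77 (convention before (1.5))] -/
theorem near_src_of_mem_plaqsOf {X : Set (Site (F.P Kt) 0)}
    (hX : ∀ x ∈ X, ∃ z₁ z : Pt (F.P Kt).d, cover (F.P Kt) z₁ ∈ maxDomT ν.M₁ Z 1 ∧ cover (F.P Kt) z = x ∧ Within (2 * (ν.M₁ : ℤ) - 1) z₁ z)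
    {p : Plaq (F.P Kt) 0} (hp : p ∈ plaqsOf X) :
    ∃ z₁ z : Pt (F.P Kt).d, cover (F.P Kt) z₁ ∈ maxDomT ν.M₁ Z 1 ∧ cover (F.P Kt) z = p.src ∧ Within (2 * (ν.M₁ : ℤ) - 1 + 1 + 1) z₁ z := by
  rcases (mem_plaqsOf X p).1 hp with h | h | h | h
  · exact near_mono (by linarith) (hX _ h)
  · have := near_unshift (hX _ h) p.μ
    rw [unshift_shift] at this
    exact near_mono (by linarith) this
  · have := near_unshift (hX _ h) p.ν
    rw [unshift_shift] at this
    exact near_mono (by linarith) this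
  · have := near_unshift (near_unshift (hX _ h) p.ν) p.μ
    rw [unshift_shift, unshift_shift] at this
    exact this

/-- The plaquette variable at a source witnessed at radius `2M₁ + 1` reads only bonds inside `Z`. [cite: Balaban1988Convergent, (2.13) pp.256–257; Balaban1985Averaging, (9) p.19] -/
theorem plaqHol_congr_of_near_src (hM4 : 4 ≤ ν.M₁) (hk1 : 1 ≤ k) (hdiv : side (F.P Kt).L ν.M₁ k ∣ (F.P Kt).sitesPerDir 0)
    {G : Type*} [GaugeGroup G] {U U' : GaugeField (F.P Kt) 0 G} (h : ∀ b : PBond (F.P Kt) 0, b.src ∈ Z → b.tgt ∈ Z → U b = U' b)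
    {y : Site (F.P Kt) 0} (hy : ∃ z₁ z : Pt (F.P Kt).d, cover (F.P Kt) z₁ ∈ maxDomT ν.M₁ Z 1 ∧ cover (F.P Kt) z = y ∧ Within (2 * (ν.M₁ : ℤ) - 1 + 1 + 1) z₁ z)
    (α β : Fin (F.P Kt).d) (hαβ : α < β) : plaqHol U ⟨y, α, β, hαβ⟩ = plaqHol U' ⟨y, α, β, hαβ⟩ := by
  have hM : 1 ≤ ν.M₁ := le_trans (by norm_num) hM4
  have hm := margin_le (F := F) (Kt := Kt) hM4
  refine plaqHol_congr_of_corners (X := Z) h _ ?_ ?_ ?_ ?_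
  · exact mem_of_near hM hk1 hdiv (by linarith) hy
  · exact mem_of_near hM hk1 hdiv (by linarith) (near_shift hy α)
  · exact mem_of_near hM hk1 hdiv (by linarith) (near_shift hy β)
  · exact mem_of_near hM hk1 hdiv (by linarith) (near_shift (near_shift hy α) β)

/-- The support of record `Ω₀(s)` and every `Ω_j(Z)`, `j ≥ 1`, have cover witnesses at radius `2M₁ − 1`. [cite: Balaban1988Convergent, p.255, (2.13) pp.256–257] -/
theorem near_of_mem_topSeq (hM : 1 ≤ ν.M₁) (j : ℕ) {x : Site (F.P Kt) 0}
    (hx : x ∈ Node00.topSeq (Node00.suppDomOfRecord F ν Kt (maxDomT ν.M₁ Z)) (maxDomT ν.M₁ Z) j) :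
    ∃ z₁ z : Pt (F.P Kt).d, cover (F.P Kt) z₁ ∈ maxDomT ν.M₁ Z 1 ∧ cover (F.P Kt) z = x ∧ Within (2 * (ν.M₁ : ℤ) - 1) z₁ z := by
  rcases Nat.eq_zero_or_pos j with rfl | hj
  · rw [Node00.topSeq_zero, Node00.suppDomOfRecord_eq] at hx
    exact near_of_mem_hullD hx
  · rw [Node00.topSeq_of_ne_zero _ _ hj.ne'] at hx
    exact near_mono (by linarith [show (1 : ℤ) ≤ ν.M₁ by exact_mod_cast hM]) (near_of_mem_maxDomT hM hj hx)

/-- ★★ **NODE 00's CLASS `U_k({Ω_j(Z)}, εr)` READS ONLY THE FINE BONDS WITH BOTH ENDS IN `Z`**: two configurations agreeing there are in the class together ((1.7) on the plaquettes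
meeting `Ω₀(s) ⊇ Ω_j`, (1.9) on the bonds meeting them — all within `2M₁ + 3 ≤ L·M₁ − 1` of `Ω₁(Z)`, inside `Z`).
[cite: Balaban1985Variational, (2) p.278; Balaban1985RegularSpaces, (1.7), (1.9) p.77; Balaban1988Convergent, p.255, (2.12)–(2.13) pp.256–257] -/
theorem mem_regMSCoPOfRecord_of_eqOn_inside (hM4 : 4 ≤ ν.M₁) (hk1 : 1 ≤ k) (hdiv : side (F.P Kt).L ν.M₁ k ∣ (F.P Kt).sitesPerDir 0)
    {U U' : GaugeField (F.P Kt) 0 (Node00.SU N)} (h : ∀ b : PBond (F.P Kt) 0, b.src ∈ Z → b.tgt ∈ Z → U' b = U b)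
    (hU : U ∈ Node00.regMSCoPOfRecord F N ν Kt k (maxDomT ν.M₁ Z)) : U' ∈ Node00.regMSCoPOfRecord F N ν Kt k (maxDomT ν.M₁ Z) := by
  have hM : 1 ≤ ν.M₁ := le_trans (by norm_num) hM4
  have hm := margin_le (F := F) (Kt := Kt) hM4
  have h' : ∀ b : PBond (F.P Kt) 0, b.src ∈ Z → b.tgt ∈ Z → U b = U' b := fun b hs ht => (h b hs ht).symm
  rw [Node00.regMSCoPOfRecord, Node00.mem_regMSCoPOfRecordAt_iff] at hU ⊢
  refine ⟨fun j hj p hp => ?_, fun j hj b hb => ?_⟩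
  · -- (1.7): the plaquette meets the region, so all four corners are inside `Z`
    have hsrc := near_src_of_mem_plaqsOf (fun x hx => near_of_mem_topSeq hM j hx) hp
    rw [show p = ⟨p.src, p.μ, p.ν, p.hμν⟩ from rfl, ← plaqHol_congr_of_near_src hM4 hk1 hdiv h' hsrc]
    exact hU.1 j hj p hp
  · -- (1.9): the co-divergence at a bond meeting the region reads plaquettes at `b₋`, `b₋ − e_ν` and the bonds `⟨b₋ − e_ν, ν⟩`
    have hsrc : ∃ z₁ z : Pt (F.P Kt).d, cover (F.P Kt) z₁ ∈ maxDomT ν.M₁ Z 1 ∧ cover (F.P Kt) z = b.src ∧ Within (2 * (ν.M₁ : ℤ) - 1 + 1) z₁ z := by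
      rcases hb with hs | ht
      · exact near_mono (by linarith) (near_of_mem_topSeq hM j hs)
      · have := near_unshift (near_of_mem_topSeq hM j ht) b.dir
        rwa [show b.tgt.unshift b.dir = b.src from unshift_shift _ _] at this
    rw [← coDivSum_congr (U := U) (U' := U') (fun y hy α β hαβ => ?_) (fun μ => h' _ ?_ ?_)]
    · exact hU.2 j hj b hb
    · rcases hy with rfl | ⟨μ, rfl⟩
      · exact plaqHol_congr_of_near_src hM4 hk1 hdiv h' (near_mono (by linarith) hsrc) α β hαβ
      · exact plaqHol_congr_of_near_src hM4 hk1 hdiv h' (near_unshift hsrc μ) α β hαβ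
    · exact mem_of_near hM hk1 hdiv (by linarith) (near_unshift hsrc μ)
    · rw [show (⟨b.src.unshift μ, μ⟩ : PBond (F.P Kt) 0).tgt = b.src from shift_unshift _ _]
      exact mem_of_near hM hk1 hdiv (by linarith) hsrc

end ClassLocality

end Summit.QuantumFields.YangMills.BalabanUVNodes.N12FarDatumSurgeryPrelim

end
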